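import Literature.AlgebraicGeometry.AbelianSchemes.LevelStructureTorsionPointsBasis   -- ★ `restrictPt_section_injective`, `exists_restrictPt_section_eq`, `restrictPt_σ_pow_eq_one`
import Literature.AlgebraicGeometry.AbelianSchemes.AbelianSchemeOverSectionPow         -- ★ `restrictPt_sectionPow_eq_prod`, `isCommMonObj_fibre`
import Literature.AlgebraicGeometry.AbelianSchemes.AbelianSchemeOverFibreDim           -- ★ `dim_fibre_of_isOfRelDim`
import Literature.AlgebraicGeometry.Motives.AbelianVarietyPTorsionPointsLt             -- ★ (P-TOR) `natCard_pow_eq_one_lt_pow_two_mul_dim`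
import Literature.AlgebraicGeometry.Motives.AbelianVarietyTorsionPointsCountProofs     -- ★ `natCard_torsionPoints_eq_of_isAlgClosed`
import HarnessLib

/-!
# A full level-`N` structure on an abelian scheme of relative dimension `g ≥ 1` forces `p ∤ N` at every geometric point of characteristic `p`
# ([MumfordFogartyKirwan1994] Ch. 7 §2 Def. 7.1 and §3 Thm. 7.9 (standing hypothesis «`n` invertible»); [Mumford AV] §15 p. 147, §6 App. 3 p. 64)

Topic `Literature/AlgebraicGeometry/AbelianSchemes`; namespace `Literature.AlgebraicGeometry.AbelianSchemes.AbelianSchemeOver.LevelStructure`.  THEOREMS ONLY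
(no definition, no named fact, no instance, no notation, no `sorry`).  Cell `hodgecm-mathlib` (D-0151), F0∕P6 «MOD», line L2, the «`p ∤ N` JUNCTION» (LA6-p03 (g2)
2026-09-02T07:17:15Z; LEAD F0P6-plan (g4) «M-75» (O2′); LA2-plan (g2) RULINGS #3 (1)): the GENERIC form of the leaflet corollary `coprime_pChar_N_of_specialPoint` —
the interim binder `(hpN : Nat.Coprime I.pChar I.N)` of the L2 heads is a THEOREM of the datum (`I.lvl`, `I.relDim`, `I.charP₀`, `0 < I.g`) at any special point.
`--supports stmt-HodgeConjecture-24832`, count-neutral.  HONEST LABEL: HC_CM is proved only modulo the printed citations (2 remaining named inputs hLiu418 24832,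
h413 24833) until rung 0 closes; this file is generic and discharges none of them.

## Mathematics

`A∕S` an abelian scheme of relative dimension `g ≥ 1` with a level-`N` structure `φ` (★ `LevelStructure`: `2g` sections `σᵢ` with `σᵢ^N = 1` whose values at every
geometric point `s : Spec Ω → S` enumerate the `N`-torsion `A_s[N](Ω)` BIJECTIVELY by `a ↦ σ^a(s)`, `a ∈ (ℤ∕N)^{2g}`), and `s` a geometric point whose field `Ω` has
characteristic `p` (a prime).  THEN `p ∤ N` (no hypothesis `N ≠ 0`):
* if `N = 0` (`ℤ∕0 = ℤ`; the carrier's junk level): every `Ω`-point of `A_s` is some `σ^a(s)` (surjectivity at exponent `0`: `x^0 = 1`), and for a prime `ℓ ≠ p` an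
  `ℓ`-torsion point `P = σ^a(s) = ∏ σₖ(s)^{|aₖ|}` has `1 = P^ℓ = σ^{(ℓ|aₖ|)ₖ}(s)`, so `ℓ|aₖ| = 0` by injectivity, `a = 0`, `P = 1`: `A_s[ℓ](Ω) = 1` — against
  `#A_s[ℓ](Ω) = ℓ^{2g} ≥ 4` (★ `natCard_torsionPoints_eq_of_isAlgClosed`, [MumfordAV1970] §6 App. 3);
* if `N = p·m > 0`: the `p^{2g}` points `σ^{(m·cₖ)ₖ}(s)`, `c ∈ (ℤ∕p)^{2g}`, are pairwise distinct (injectivity; `m·cₖ < N`) and killed by `p` (`(∏ σₖ(s)^{m cₖ})^p =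
  ∏ (σₖ(s)^N)^{cₖ} = 1`), so `#{x ∈ A_s(Ω) | x^p = 1} ≥ p^{2g}` — against ★ (P-TOR) `natCard_pow_eq_one_lt_pow_two_mul_dim` (`< p^{2 dim A_s} = p^{2g}` in
  characteristic `p`, [MumfordAV1970] §15).

* **`coprime_of_charP`** — THE HEAD: `φ : A.LevelStructure g N`, `A.IsOfRelDim g`, `0 < g`, `s : Spec Ω → S` with `Ω` algebraically closed of characteristic `p` ⟹ `Nat.Coprime p N`.

## References
* [MumfordFogartyKirwan1994] D. Mumford, J. Fogarty, F. Kirwan, *Geometric Invariant Theory* (3rd ed. 1994), Ch. 7 §2 Def. 7.1 (p. 129), §3 Thm. 7.9 (p. 139).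
* [MumfordAV1970] D. Mumford, *Abelian Varieties* (1970), §6 Application 3 (Proposition p. 64), §15 (p. 147).
* [GortzWedhorn2023] U. Görtz, T. Wedhorn, *Algebraic Geometry II* (2023), Prop. 27.188 (p. 888).
-/

set_option autoImplicit false

noncomputable section

universe u

open CategoryTheory CategoryTheory.Limits AlgebraicGeometry
open scoped MonObj

namespace Literature.AlgebraicGeometry.AbelianSchemes

namespace AbelianSchemeOver

namespace LevelStructure

open Literature.AlgebraicGeometry.Motives Literature.AlgebraicGeometry.Motives.AbelianVariety

variable {S : Scheme.{u}} {A : AbelianSchemeOver S} {g N : ℕ} (φ : LevelStructure g N A)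
  {Ω : Type u} [Field Ω] [IsAlgClosed Ω] (s : Spec (.of Ω) ⟶ S)

omit [IsAlgClosed Ω] in
/-- `σ^e(s) = ∏ₖ σₖ(s)^{eₖ mod N}` for an exponent vector of NATURAL numbers `e` read in `(ℤ∕N)^{2g}` (★ `restrictPt_sectionPow_eq_prod`, Mathlib
`ZMod.val_natCast`); at `N = 0` the reduction `mod 0` is the identity. [cite: MumfordFogartyKirwan1994, Ch. 7 §2 Definition 7.1 (p. 129)] -/
theorem restrictPt_section_natCast_eq_prod (e : Fin g ⊕ Fin g → ℕ) :
    haveI := A.isCommMonObj_fibre s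
    A.restrictPt s (φ.section_ fun k => ((e k : ℕ) : ZMod N)) = ∏ k, A.restrictPt s (φ.σ k) ^ (e k % N) := by
  haveI := A.isCommMonObj_fibre s
  rw [LevelStructure.section_, A.restrictPt_sectionPow_eq_prod s]
  exact Finset.prod_congr rfl fun k _ => by rw [ZMod.val_natCast]

include φ s in
/-- **A LEVEL-`N` STRUCTURE ON AN ABELIAN SCHEME OF RELATIVE DIMENSION `g ≥ 1` FORCES `p ∤ N` AT EVERY GEOMETRIC POINT OF CHARACTERISTIC `p`.**  For
`φ : A.LevelStructure g N`, `A.IsOfRelDim g`, `0 < g`, and a geometric point `s : Spec Ω → S` with `Ω` algebraically closed of characteristic `p` (prime):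
`Nat.Coprime p N` — with NO hypothesis `N ≠ 0` (at `N = 0` the basis clauses contradict `#A_s[ℓ](Ω) = ℓ^{2g}` for a prime `ℓ ≠ p`, ★
`natCard_torsionPoints_eq_of_isAlgClosed`; at `N = p·m` the `p^{2g}` distinct `p`-torsion points `σ^{m·c}(s)` contradict ★ (P-TOR)
`natCard_pow_eq_one_lt_pow_two_mul_dim`).  This is [MumfordFogartyKirwan1994] Thm. 7.9's standing hypothesis «`n` invertible on `S`» recovered from Def. 7.1 (i)
itself; the generic form of the line-L2 leaflet corollary `coprime_pChar_N_of_specialPoint`.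
[cite: MumfordFogartyKirwan1994, Ch. 7 §2 Definition 7.1 (p. 129), §3 Theorem 7.9 (p. 139)] [cite: MumfordAV1970, §15 (p. 147), §6 Application 3 (p. 64)] -/
theorem coprime_of_charP (hA : A.IsOfRelDim g) (hg : 0 < g) (p : ℕ) [Fact p.Prime] [CharP Ω p] : Nat.Coprime p N := by
  classical
  have hp : p.Prime := Fact.out
  haveI := A.isCommMonObj_fibre s
  -- the fibre `A_s`, an abelian variety over `Ω` of dimension `g`
  have hdim : (A.fibre s).toAbelianVariety.dim = g := dim_fibre_of_isOfRelDim hA s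
  have hσN : ∀ k, A.restrictPt s (φ.σ k) ^ N = 1 := fun k => φ.restrictPt_σ_pow_eq_one s k
  have hinj := φ.restrictPt_section_injective s
  have hone : A.restrictPt s (φ.section_ (0 : Fin g ⊕ Fin g → ZMod N)) = 1 := by
    rw [φ.section_zero, restrictPt_one]
  rw [Nat.Prime.coprime_iff_not_dvd hp]
  rintro ⟨m, hm⟩
  rcases Nat.eq_zero_or_pos N with hN0 | hNpos
  · -- ===== `N = 0`: a prime `ℓ ≠ p` has no non-trivial torsion point, against `#A_s[ℓ](Ω) = ℓ^{2g}` =====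
    subst hN0
    obtain ⟨ℓ, hℓge, hℓ⟩ := Nat.exists_infinite_primes (p + 1)
    have hℓp : ℓ ≠ p := by omega
    have hℓΩ : ((ℓ : ℤ) : Ω) ≠ 0 := by
      rw [Int.cast_natCast]
      intro h
      exact hℓp ((Nat.prime_dvd_prime_iff_eq hp hℓ).mp ((CharP.cast_eq_zero_iff Ω p ℓ).mp h)).symm
    have hcard := (A.fibre s).toAbelianVariety.natCard_torsionPoints_eq_of_isAlgClosed Ω (ℓ : ℤ) hℓΩ
    rw [Int.natAbs_natCast, hdim] at hcard
    -- every `ℓ`-torsion point is trivial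
    have htriv : ∀ P : (A.fibre s).toAbelianVariety.torsionPoints Ω (ℓ : ℤ), P = 1 := by
      intro P
      have hPℓ : (P : (A.fibre s).toAbelianVariety.Points Ω) ^ ℓ = 1 := by
        rw [← zpow_natCast]
        exact (AbelianVariety.mem_torsionPoints_iff _ _).mp P.2
      obtain ⟨a, ha⟩ := φ.exists_restrictPt_section_eq s (P : (A.fibre s).toAbelianVariety.Points Ω) (pow_zero _)
      have haℓ : A.restrictPt s (φ.section_ a) ^ ℓ = 1 := by rw [ha]; exact hPℓ
      -- `σ^a(s)^ℓ = σ^{(ℓ·|aₖ|)ₖ}(s)`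
      have hPpow : A.restrictPt s (φ.section_ a) ^ ℓ = A.restrictPt s (φ.section_ fun k => ((ℓ * (a k).val : ℕ) : ZMod 0)) := by
        rw [φ.restrictPt_section_natCast_eq_prod s, LevelStructure.section_, A.restrictPt_sectionPow_eq_prod s, ← Finset.prod_pow]
        exact Finset.prod_congr rfl fun k _ => by rw [Nat.mod_zero, ← pow_mul, mul_comm]
      have hzero : (fun k => ((ℓ * (a k).val : ℕ) : ZMod 0)) = 0 :=
        hinj (hPpow.symm.trans (haℓ.trans hone.symm))
      have ha0 : a = 0 := by
        funext k
        have hk := congrArg ZMod.val (congr_fun hzero k)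
        rw [Pi.zero_apply, ZMod.val_zero, ZMod.val_natCast, Nat.mod_zero, mul_eq_zero] at hk
        rw [Pi.zero_apply]
        exact (ZMod.val_eq_zero (a k)).mp (hk.resolve_left hℓ.ne_zero)
      apply Subtype.ext
      rw [ha0, hone] at ha
      exact ha.symm
    haveI : Subsingleton ((A.fibre s).toAbelianVariety.torsionPoints Ω (ℓ : ℤ)) := ⟨fun P Q => by rw [htriv P, htriv Q]⟩
    have h1 : Nat.card ((A.fibre s).toAbelianVariety.torsionPoints Ω (ℓ : ℤ)) = 1 := Nat.card_unique
    rw [h1] at hcard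
    have h4 : 2 ^ (2 * g) ≤ ℓ ^ (2 * g) := Nat.pow_le_pow_left hℓ.two_le _
    have h2 : 2 ≤ 2 ^ (2 * g) := by
      calc 2 = 2 ^ 1 := (pow_one 2).symm
        _ ≤ 2 ^ (2 * g) := Nat.pow_le_pow_right (by norm_num) (by omega)
    omega
  · -- ===== `N = p·m > 0`: `p^{2g}` distinct `p`-torsion points `σ^{m·c}(s)`, against (P-TOR) =====
    have hm0 : 0 < m := Nat.pos_of_ne_zero (by rintro rfl; rw [mul_zero] at hm; omega)
    haveI : NeZero N := ⟨hNpos.ne'⟩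
    -- the exponent vectors `(m · cₖ)ₖ`, `c ∈ (ℤ∕p)^{2g}`, all `< N`
    have hlt : ∀ (c : Fin g ⊕ Fin g → ZMod p) (k), m * (c k).val < N := fun c k => by
      rw [hm, mul_comm p m]
      exact Nat.mul_lt_mul_of_pos_left (ZMod.val_lt (c k)) hm0
    let x : (Fin g ⊕ Fin g → ZMod p) → (A.fibre s).toAbelianVariety.Points Ω := fun c =>
      A.restrictPt s (φ.section_ fun k => ((m * (c k).val : ℕ) : ZMod N))
    have hxpow : ∀ c, x c ^ p = 1 := by
      intro c
      change A.restrictPt s (φ.section_ _) ^ p = 1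
      rw [φ.restrictPt_section_natCast_eq_prod s, ← Finset.prod_pow]
      refine Finset.prod_eq_one fun k _ => ?_
      rw [Nat.mod_eq_of_lt (hlt c k), ← pow_mul, mul_comm m, mul_assoc, mul_comm m p, ← hm, mul_comm, pow_mul, hσN k, one_pow]
    have hxinj : Function.Injective fun c => (⟨x c, hxpow c⟩ : {y : (A.fibre s).toAbelianVariety.Points Ω // y ^ p = 1}) := by
      intro c c' hcc'
      have h := hinj (congrArg Subtype.val hcc' : x c = x c')
      funext k
      have hk := congrArg ZMod.val (congr_fun h k)
      rw [ZMod.val_natCast, ZMod.val_natCast, Nat.mod_eq_of_lt (hlt c k), Nat.mod_eq_of_lt (hlt c' k)] at hk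
      exact ZMod.val_injective p (Nat.eq_of_mul_eq_mul_left hm0 hk)
    -- finiteness of the `p`-torsion (`[p]` is an isogeny)
    have hp0 : (p : ℤ) ≠ 0 := by exact_mod_cast hp.ne_zero
    haveI : Finite ((A.fibre s).toAbelianVariety.torsionPoints Ω (p : ℤ)) :=
      finite_torsionPoints_of_isIsogeny_zsmul (isIsogeny_zsmul_id_holds (A.fibre s).toAbelianVariety (p : ℤ) hp0) Ω
    haveI : Finite {y : (A.fibre s).toAbelianVariety.Points Ω // y ^ p = 1} :=
      Finite.of_equiv ((A.fibre s).toAbelianVariety.torsionPoints Ω (p : ℤ))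
        { toFun := fun P => ⟨P.1, by have h := P.2; rw [AbelianVariety.mem_torsionPoints_iff, zpow_natCast] at h; exact h⟩
          invFun := fun y => ⟨y.1, by rw [AbelianVariety.mem_torsionPoints_iff, zpow_natCast]; exact y.2⟩
          left_inv := fun P => rfl
          right_inv := fun y => rfl }
    have hle := Nat.card_le_card_of_injective _ hxinj
    rw [Nat.card_fun, Nat.card_zmod, Nat.card_sum, Nat.card_eq_fintype_card (α := Fin g), Fintype.card_fin] at hle
    have hlt' := natCard_pow_eq_one_lt_pow_two_mul_dim p (A.fibre s).toAbelianVariety Ω (by rw [hdim]; exact hg)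
    rw [hdim] at hlt'
    have : p ^ (g + g) = p ^ (2 * g) := by rw [two_mul]
    omega

end LevelStructure

end AbelianSchemeOver

end Literature.AlgebraicGeometry.AbelianSchemes

end
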